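import Summits.NavierStokesRegularity.NavierStokesRegularity.Theorems.SoloRefuteRamm2024
import Literature.Claims.NS.Ramm2019
import Literature.Analysis.FluidPDE.FujitaKatoGlobal
import Literature.Analysis.FluidPDE.HomSobolevRepresentedL3
import Literature.Analysis.FunctionSpaces.HomSobolevInterpolation
import Literature.Analysis.FunctionSpaces.FourierSobolevNormProofs
import Mathlib.Analysis.Distribution.Sobolev
import HarnessLib

/-!
# C04b `Ramm2019` — refutation of Step 2 (the hyper-singular inequality (e10)) of the typed skeleton

D-0090 NS-CLAIMS SWEEP, cell `ns-claims`, refuter-2 (witness + assembly), filed by the salvage prover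
under the cell's interim convention (b).  Skeleton: `Literature.Claims.NS.Ramm2019` (typist-4), the
2019 twin (arXiv:1904.11569v1, class `X = C([0,T]; L²)` mild solutions, `ψ(t) = ‖v(·,t)‖_{Ḣ¹}` on the
Fourier side) of the 2024 paper adjudicated in `…Theorems.SoloRefuteRamm2024` (C04).

**The step.** `Step2_hyperSingularIneq`: for every admissible datum `(ν, v₀)` there is `c > 0` such that
every global `X`-solution `v` satisfies, with `w = Φ_{−1/4} ⋆ ψ` in the Laplace sense
(`IsPhiConv (−1/4) ψ w`), `ψ(t) < ∞` and `ψ(t) ≤ ψ₀(t) − c·c₁·w(t)` for all `t > 0` ((e6)⇒(e10),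
l.214–263 of the source).

**The countermodel.** `ν = 1`, `v₀ = c₀ · curl(φ e₃)` (`testDatum` of C04, `φ` a smooth bump) with `c₀ > 0`
so small that `‖v₀‖_{Ḣ^{1/2}} ≤ δν` for the tree's Fujita–Kato constant: the global Fujita–Kato mild
solution `v ∈ C([0,∞); Ḣ^{1/2}) ∩ C([0,∞); L²)`, `v(0) = v₀` (`fujita_kato_global_small_holds`) is a
global `X`-solution.  Then
* `ψ₀(t) = ‖e^{νtΔ}v₀‖_{Ḣ¹} ≤ ‖v₀‖_{Ḣ¹} =: B` (heat contraction, `Function.eHomSobolevSeminorm_heatExtension_le`);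
* `ψ(t) ≥ β > 0` on some `(0, δ)` wherever `ψ(t) < ∞`: by continuity at `t = 0⁺`,
  `‖v(t)‖_{Ḣ^{1/2}} ≥ ‖v₀‖_{Ḣ^{1/2}}/2 > 0` (positivity via `Ḣ^{1/2} ⊂ L³`) and `‖v(t)‖_{L²} ≤ ‖v₀‖_{L²} + 1`,
  and the interpolation inequality `‖·‖_{Ḣ^{1/2}}² ≤ ‖·‖_{L²} ‖·‖_{Ḣ¹}` (BCD Prop. 1.32);
* the NS-free core `…Theorems.Ramm2024.false_of_hyperSingular` (C04 part A): the Laplace transform of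
  the inequality gives `c·c₁·β(1 − e^{−pδ}) p^{1/4} ≤ B` for all `p > 0`, absurd as `p → ∞`.

Main results: `not_step2_of_witness` (packaging), `not_step2_of_testField` (any nonzero smooth compactly
supported divergence-free field), `not_Step2_hyperSingularIneq`.  Step 1 of the skeleton (energy bound
over the class `X`) is not used.  Classification: refuted-substantive for the typed step (the witness is
an arbitrary nonzero admissible datum; no side condition repairs (e10)).

WHAT THIS IS NOT: not a claim about NS regularity or blow-up; not a claim about any author beyond the
typed locator.
-/

open MeasureTheory Set Filter Topology
open scoped SchwartzMap ENNReal ContDiff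

namespace Summit.NavierStokesRegularity.NavierStokesRegularity.Theorems.Ramm2019

open Literature.Analysis Literature.Analysis.FunctionSpaces Literature.Analysis.FluidPDE
open Literature.Analysis.Asymptotics
open Literature.Claims.NS.Ramm2019
open Summit.NavierStokesRegularity.NavierStokesRegularity.Theorems.Ramm2024
  (false_of_hyperSingular mul_c₁_pos testDatum contDiff_testDatum hasCompactSupport_testDatum
    isDivFree_testDatum testDatum_ne_zero)

-- The summit's canonical theorem namespace repeats the summit name (single-conjunct summit).
set_option linter.dupNamespace false

noncomputable section

/-! ### `Ḣ^s ∩ L²` membership of complexified test fields -/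

/-- A smooth compactly supported vector field, complexified coordinatewise, lies in
`Ḣ^s ∩ L²` for every `s ≥ 0` (Schwartz ⊂ H^s ⊂ Ḣ^s ∩ L²). -/
theorem memHomSobolev_complexify_of_hasCompactSupport
    {f : EuclideanSpace ℝ (Fin 3) → EuclideanSpace ℝ (Fin 3)}
    (hsm : ContDiff ℝ ∞ f) (hcs : HasCompactSupport f) {s : ℝ} (hs : 0 ≤ s) :
    MemHomSobolev s (EuclideanSpace.complexify ∘ f) := by
  have hsm' : ContDiff ℝ ∞ (EuclideanSpace.complexify ∘ f) :=
    EuclideanSpace.contDiff_complexify_comp_iff.2 hsm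
  have hcs' : HasCompactSupport (EuclideanSpace.complexify ∘ f) := hcs.comp_left (map_zero _)
  set g : 𝓢(EuclideanSpace ℝ (Fin 3), EuclideanSpace ℂ (Fin 3)) := hcs'.toSchwartzMap hsm'
    with hg
  have hMS : TemperedDistribution.MemSobolev s 2
      ((g.toLp 2 (volume : Measure (EuclideanSpace ℝ (Fin 3))) :
      𝓢'(EuclideanSpace ℝ (Fin 3), EuclideanSpace ℂ (Fin 3)))) := by
    have h := Lp.toTemperedDistribution_toLp_eq
      (μ := (volume : Measure (EuclideanSpace ℝ (Fin 3)))) (p := 2) g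
    rw [show ((g : Lp (EuclideanSpace ℂ (Fin 3)) 2 (volume : Measure (EuclideanSpace ℝ (Fin 3))))
      = g.toLp 2 volume) from rfl] at h
    rw [h]
    exact g.memSobolev
  have hfin := (memSobolev_two_iff_eFourierSobolevNorm_lt_top_holds s _).1 hMS
  exact MemFourierSobolev.memHomSobolev_holds hs ⟨g.memLp 2 _, hfin⟩

/-- Complexification commutes with real scalars: `complexify ∘ (c • f) = (c : ℂ) • (complexify ∘ f)`. -/
theorem complexify_comp_smul (c : ℝ) (f : EuclideanSpace ℝ (Fin 3) → EuclideanSpace ℝ (Fin 3)) :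
    EuclideanSpace.complexify ∘ (c • f) = (c : ℂ) • (EuclideanSpace.complexify ∘ f) := by
  funext x
  ext i
  simp [EuclideanSpace.complexify_apply]

/-- `‖complexify ∘ (c • f)‖_{Ḣ^s} = c · ‖complexify ∘ f‖_{Ḣ^s}` for `c > 0`. -/
theorem eHomSobolevSeminorm_complexify_smul (s : ℝ) {c : ℝ} (hc : 0 < c)
    (f : EuclideanSpace ℝ (Fin 3) → EuclideanSpace ℝ (Fin 3)) :
    Function.eHomSobolevSeminorm s (EuclideanSpace.complexify ∘ (c • f)) =
      ENNReal.ofReal c * Function.eHomSobolevSeminorm s (EuclideanSpace.complexify ∘ f) := by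
  rw [complexify_comp_smul, function_eHomSobolevSeminorm_const_smul s (a := (c : ℂ))
    (by exact_mod_cast hc.ne'), ← ofReal_norm, Complex.norm_real, Real.norm_eq_abs,
    abs_of_pos hc]

/-! ### The Fujita–Kato witness -/

/-- **Witness.** For `ν > 0` and any nonzero smooth compactly supported divergence-free field `f`,
a small positive multiple `u₀ = c • f` has a global Fujita–Kato mild solution
`u ∈ C([0,∞); Ḣ^{1/2}) ∩ C([0,∞); L²)` with `u 0 = u₀` (tree: `fujita_kato_global_small_holds`). -/
theorem exists_fujitaKato_witness {ν : ℝ} (hν : 0 < ν)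
    {f : EuclideanSpace ℝ (Fin 3) → EuclideanSpace ℝ (Fin 3)} (hsm : ContDiff ℝ ∞ f)
    (hcs : HasCompactSupport f) (hdiv : VectorCalculus.IsDivFree f) :
    ∃ c : ℝ, 0 < c ∧ ∃ u : ℝ → EuclideanSpace ℝ (Fin 3) → EuclideanSpace ℝ (Fin 3),
      IsGlobalMildSolution ν 0 (c • f) u ∧ ContinuousInHomSobolevOn (Ici 0) (1 / 2 : ℝ) u ∧
      ContinuousInLpOn (Ici 0) 2 u ∧ u 0 = c • f := by
  obtain ⟨δ, hδ, hFK⟩ := fujita_kato_global_small_holds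
  set N := Function.eHomSobolevSeminorm (1 / 2 : ℝ) (EuclideanSpace.complexify ∘ f) with hN
  have hNtop : N ≠ ⊤ :=
    (memHomSobolev_complexify_of_hasCompactSupport hsm hcs
      (by norm_num : (0 : ℝ) ≤ 1 / 2)).eHomSobolevSeminorm_lt_top.ne
  set c : ℝ := δ * ν / (N.toReal + 1) with hc
  have hcpos : 0 < c := div_pos (mul_pos hδ hν) (by positivity)
  have hsmc : ContDiff ℝ ∞ (c • f) := hsm.const_smul c
  have hcsc : HasCompactSupport (c • f) :=
    hcs.smul_left (f := fun _ : EuclideanSpace ℝ (Fin 3) => c)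
  have hdivc : VectorCalculus.IsDivFree (c • f) :=
    VectorCalculus.IsDivFree.const_smul (hsm.differentiable (by simp)) hdiv c
  have hwdiv : IsWeaklyDivFree (c • f) :=
    VectorCalculus.IsDivFree.isWeaklyDivFree_holds hdivc (hsmc.of_le (by exact_mod_cast le_top))
  have hH : MemHomSobolev (1 / 2 : ℝ) (EuclideanSpace.complexify ∘ (c • f)) :=
    memHomSobolev_complexify_of_hasCompactSupport hsmc hcsc (by norm_num)
  have hsmall : Function.eHomSobolevSeminorm (1 / 2 : ℝ) (EuclideanSpace.complexify ∘ (c • f)) ≤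
      ENNReal.ofReal (δ * ν) := by
    rw [eHomSobolevSeminorm_complexify_smul _ hcpos, ← hN, ← ENNReal.ofReal_toReal hNtop,
      ← ENNReal.ofReal_mul hcpos.le]
    refine ENNReal.ofReal_le_ofReal ?_
    rw [hc, div_mul_eq_mul_div, div_le_iff₀ (by positivity)]
    nlinarith [ENNReal.toReal_nonneg (a := N), mul_pos hδ hν]
  obtain ⟨u, hmild, hcH, hcL, h0, -⟩ := hFK ν hν (c • f) hH hwdiv hsmall
  exact ⟨c, hcpos, u, hmild, hcH, hcL, h0⟩

/-- A global Fujita–Kato solution is a global `X`-solution in the sense of the skeleton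
(restriction of the mild formulation and of the `L²` continuity from `[0,∞)` to `[0,T]`). -/
theorem isGlobalX_of_global {ν : ℝ} {u₀ : EuclideanSpace ℝ (Fin 3) → EuclideanSpace ℝ (Fin 3)}
    {u : ℝ → EuclideanSpace ℝ (Fin 3) → EuclideanSpace ℝ (Fin 3)}
    (hmild : IsGlobalMildSolution ν 0 u₀ u) (hcL : ContinuousInLpOn (Ici 0) 2 u) (h0 : u 0 = u₀) :
    IsGlobalX ν u₀ u := fun _ _ =>
  ⟨⟨fun t ht => hmild.1 t (mem_Ici.2 ht.1), fun t ht => hmild.2 t (mem_Ici.2 ht.1)⟩,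
    hcL.mono fun _ ht => mem_Ici.2 ht.1, h0⟩

/-! ### Upper bound for `ψ₀` -/

/-- For `u₀` with `complexify ∘ u₀ ∈ Ḣ¹ ∩ L²`: `ψ₀(t) ≤ ‖u₀‖_{Ḣ¹}` for all `t > 0`
(the heat semigroup contracts every `Ḣ^s` seminorm). -/
theorem psi0_le {ν : ℝ} (hν : 0 < ν) {u₀ : EuclideanSpace ℝ (Fin 3) → EuclideanSpace ℝ (Fin 3)}
    (h1 : MemHomSobolev 1 (EuclideanSpace.complexify ∘ u₀)) :
    ∃ B : ℝ, ∀ t : ℝ, 0 < t → psi0 ν u₀ t ≤ B := by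
  refine ⟨(Function.eHomSobolevSeminorm 1 (EuclideanSpace.complexify ∘ u₀)).toReal, fun t ht => ?_⟩
  unfold psi0
  rw [heatTest_of_pos hν ht, EuclideanSpace.complexify_comp_heatExtension]
  exact ENNReal.toReal_mono h1.eHomSobolevSeminorm_lt_top.ne
    (Function.eHomSobolevSeminorm_heatExtension_le 1 _ (mul_pos hν ht))

/-! ### Lower bound for `ψ` near `t = 0⁺` -/

/-- A nonzero continuous `L²` field has positive `Ḣ^{1/2}` seminorm (Sobolev embedding
`Ḣ^{1/2} ⊂ L³`: a vanishing seminorm forces `‖u₀‖_{L³} = 0`, hence `u₀ = 0` by continuity). -/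
theorem eHomSobolevSeminorm_half_ne_zero {u₀ : EuclideanSpace ℝ (Fin 3) → EuclideanSpace ℝ (Fin 3)}
    (hne : u₀ ≠ 0) (hc : Continuous u₀) (h2 : MemLp u₀ 2 volume) :
    Function.eHomSobolevSeminorm (1 / 2 : ℝ) (EuclideanSpace.complexify ∘ u₀) ≠ 0 := by
  intro h0
  obtain ⟨C, hC⟩ :=
    eLpNorm_three_le_eHomSobolevSeminorm_half_holds (F := EuclideanSpace ℂ (Fin 3))
  have h3 := hC (EuclideanSpace.complexify ∘ u₀) (memLp_complexify_comp h2)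
  rw [h0, mul_zero, nonpos_iff_eq_zero, eLpNorm_complexify_comp,
    eLpNorm_eq_zero_iff hc.aestronglyMeasurable (by norm_num)] at h3
  exact hne ((Continuous.ae_eq_iff_eq volume hc continuous_const).1 h3)

/-- **Lower bound.** For a nonzero continuous datum and `u ∈ C([0,∞); Ḣ^{1/2}) ∩ C([0,∞); L²)`
with `u 0 = u₀`: there are `β, δ > 0` with `β ≤ ψ(t)` for all `t ∈ (0, δ)` at which `ψ(t)` is
finite (interpolation `‖·‖_{Ḣ^{1/2}}² ≤ ‖·‖_{L²} ‖·‖_{Ḣ¹}` and continuity at `t = 0`). -/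
theorem psi_lower_bound {u₀ : EuclideanSpace ℝ (Fin 3) → EuclideanSpace ℝ (Fin 3)}
    {u : ℝ → EuclideanSpace ℝ (Fin 3) → EuclideanSpace ℝ (Fin 3)} (hne : u₀ ≠ 0)
    (hc : Continuous u₀) (hcH : ContinuousInHomSobolevOn (Ici 0) (1 / 2 : ℝ) u)
    (hcL : ContinuousInLpOn (Ici 0) 2 u) (h0 : u 0 = u₀) :
    ∃ β δ : ℝ, 0 < β ∧ 0 < δ ∧ ∀ t ∈ Ioo (0 : ℝ) δ, psiE u t ≠ ⊤ → β ≤ psi u t := by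
  subst h0
  have h0mem : (0 : ℝ) ∈ Ici (0 : ℝ) := mem_Ici.2 le_rfl
  set A := Function.eHomSobolevSeminorm (1 / 2 : ℝ) (EuclideanSpace.complexify ∘ u 0) with hA
  have h2 : MemLp (u 0) 2 volume := hcL.1 0 h0mem
  have hA0 : A ≠ 0 := eHomSobolevSeminorm_half_ne_zero hne hc h2
  have hAtop : A ≠ ⊤ := (hcH.1 0 h0mem).eHomSobolevSeminorm_lt_top.ne
  have hA2 : (0 : ℝ≥0∞) < A / 2 := ENNReal.half_pos hA0
  set L := eLpNorm (u 0) 2 volume with hL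
  have hLtop : L ≠ ⊤ := h2.eLpNorm_ne_top
  -- the positive constant
  set βE : ℝ≥0∞ := (A / 2) ^ 2 / (L + 1) with hβE
  have hβE0 : βE ≠ 0 := ENNReal.div_ne_zero.2 ⟨pow_ne_zero 2 hA2.ne', by simpa using hLtop⟩
  have hβEtop : βE ≠ ⊤ := (ENNReal.div_lt_top (ENNReal.pow_ne_top
    (ENNReal.div_ne_top hAtop two_ne_zero)) (by simp)).ne
  -- continuity at `t = 0⁺`
  have hev1 : ∀ᶠ t in 𝓝[Ici 0] 0, Function.eHomSobolevSeminorm (1 / 2 : ℝ)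
      (EuclideanSpace.complexify ∘ (u t - u 0)) < A / 2 :=
    (hcH.2 0 h0mem).eventually (gt_mem_nhds hA2)
  have hev2 : ∀ᶠ t in 𝓝[Ici 0] 0, eLpNorm (u t - u 0) 2 volume < 1 :=
    (hcL.2 0 h0mem).eventually (gt_mem_nhds zero_lt_one)
  obtain ⟨δ, hδ, hball⟩ := Metric.eventually_nhds_iff.1 (eventually_nhdsWithin_iff.1 (hev1.and hev2))
  refine ⟨βE.toReal, δ, ENNReal.toReal_pos hβE0 hβEtop, hδ, fun t ht hfin => ?_⟩
  have htI : t ∈ Ici (0 : ℝ) := mem_Ici.2 ht.1.le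
  obtain ⟨hH, hL2⟩ := hball (by rw [Real.dist_eq, sub_zero, abs_of_pos ht.1]; exact ht.2) htI
  -- `A/2 ≤ ‖u t‖_{Ḣ^{1/2}}`
  have hsum : EuclideanSpace.complexify ∘ u 0 =
      EuclideanSpace.complexify ∘ u t + EuclideanSpace.complexify ∘ (u 0 - u t) := by
    funext x; simp
  have hneg : EuclideanSpace.complexify ∘ (u 0 - u t) = -(EuclideanSpace.complexify ∘ (u t - u 0)) := by
    funext x; simp [map_sub]
  have hAle : A ≤ Function.eHomSobolevSeminorm (1 / 2 : ℝ) (EuclideanSpace.complexify ∘ u t) +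
      Function.eHomSobolevSeminorm (1 / 2 : ℝ) (EuclideanSpace.complexify ∘ (u t - u 0)) := by
    rw [hA, hsum, ← Function.eHomSobolevSeminorm_neg (1 / 2 : ℝ)
      (EuclideanSpace.complexify ∘ (u t - u 0)), ← hneg]
    exact Function.eHomSobolevSeminorm_add_le _ _ _
  have hhalf : A / 2 ≤ Function.eHomSobolevSeminorm (1 / 2 : ℝ) (EuclideanSpace.complexify ∘ u t) := by
    refine le_of_not_gt fun hlt => ?_
    have := ENNReal.add_lt_add hlt hH
    rw [ENNReal.add_halves] at this
    exact absurd (hAle.trans_lt this) (lt_irrefl _)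
  -- `‖u t‖_{L²} ≤ L + 1`
  have hm0 : AEStronglyMeasurable (u 0) volume := h2.1
  have hmt : AEStronglyMeasurable (u t) volume := (hcL.1 t htI).1
  have hLt : eLpNorm (EuclideanSpace.complexify ∘ u t) 2 volume ≤ L + 1 := by
    rw [eLpNorm_complexify_comp]
    have h := eLpNorm_add_le hm0 (hmt.sub hm0) one_le_two (μ := volume)
    rw [add_sub_cancel] at h
    exact h.trans (add_le_add le_rfl hL2.le)
  -- interpolation `‖·‖_{Ḣ^{1/2}} ≤ ‖·‖_{L²}^{1/2} ‖·‖_{Ḣ¹}^{1/2}`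
  have hft : MemLp (EuclideanSpace.complexify ∘ u t) 2 volume := (hcH.1 t htI).memLp
  have hint := Function.eHomSobolevSeminorm_le_eLpNorm_rpow_mul_rpow (s := 1 / 2) (s₁ := 1)
    (by norm_num) (by norm_num) one_pos hft
  norm_num at hint
  rw [← ENNReal.mul_rpow_of_nonneg _ _ (by norm_num : (0 : ℝ) ≤ 1 / 2)] at hint
  have hsq : (A / 2) ^ 2 ≤ eLpNorm (EuclideanSpace.complexify ∘ u t) 2 volume *
      Function.eHomSobolevSeminorm 1 (EuclideanSpace.complexify ∘ u t) := by
    have key : ((eLpNorm (EuclideanSpace.complexify ∘ u t) 2 volume *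
        Function.eHomSobolevSeminorm 1 (EuclideanSpace.complexify ∘ u t)) ^ (1 / 2 : ℝ)) ^ 2 =
        eLpNorm (EuclideanSpace.complexify ∘ u t) 2 volume *
          Function.eHomSobolevSeminorm 1 (EuclideanSpace.complexify ∘ u t) := by
      rw [← ENNReal.rpow_natCast, ← ENNReal.rpow_mul]
      norm_num
    exact (pow_le_pow_left' (hhalf.trans hint) 2).trans_eq key
  have hβle : βE ≤ psiE u t := by
    rw [hβE]
    exact ENNReal.div_le_of_le_mul' (hsq.trans (mul_le_mul' hLt le_rfl))
  exact ENNReal.toReal_mono hfin hβle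

/-! ### Packaging -/

/-- **¬ Step 2 from one witness.** A global `X`-solution for admissible data with `ψ ≥ β > 0`
on some `(0,δ)` (wherever finite) and `ψ₀ ≤ B` on `(0,∞)` contradicts inequality (e10):
its Laplace transform gives `c c₁ β (1 − e^{−pδ}) p^{1/4} ≤ B` for all `p > 0`. -/
theorem not_step2_of_witness {ν : ℝ} {u₀ : EuclideanSpace ℝ (Fin 3) → EuclideanSpace ℝ (Fin 3)}
    {u : ℝ → EuclideanSpace ℝ (Fin 3) → EuclideanSpace ℝ (Fin 3)} (hD : DataHyp ν u₀)
    (hX : IsGlobalX ν u₀ u)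
    (hlow : ∃ β δ : ℝ, 0 < β ∧ 0 < δ ∧ ∀ t ∈ Ioo (0 : ℝ) δ, psiE u t ≠ ⊤ → β ≤ psi u t)
    (hB : ∃ B : ℝ, ∀ t : ℝ, 0 < t → psi0 ν u₀ t ≤ B) :
    ¬ Literature.Claims.NS.Ramm2019.Step2_hyperSingularIneq := by
  intro h2
  obtain ⟨c, hc, hall⟩ := h2 ν u₀ hD
  obtain ⟨w, hphi, hineq⟩ := hall u hX
  obtain ⟨β, δ, hβ, hδ, hlow⟩ := hlow
  obtain ⟨B, hB⟩ := hB
  refine false_of_hyperSingular (b := psi u) (b0 := psi0 ν u₀) (w := w)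
    (k := c * Literature.Claims.NS.Ramm2024.c₁) (B := B)
    (mul_c₁_pos hc) hβ hδ (fun t _ => ENNReal.toReal_nonneg) hB
    (fun t ht => hlow t ht (hineq t ht.1).1) (fun q hq => hphi.2 q hq) fun t ht => ?_
  have := (hineq t ht).2
  linarith

/-- **Refutation of Step 2 of the 2019 skeleton from any nonzero admissible test field.** -/
theorem not_step2_of_testField {f : EuclideanSpace ℝ (Fin 3) → EuclideanSpace ℝ (Fin 3)}
    (hsm : ContDiff ℝ ∞ f) (hcs : HasCompactSupport f) (hdiv : VectorCalculus.IsDivFree f)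
    (hne : f ≠ 0) : ¬ Literature.Claims.NS.Ramm2019.Step2_hyperSingularIneq := by
  obtain ⟨c, hc, u, hmild, hcH, hcL, h0⟩ := exists_fujitaKato_witness one_pos hsm hcs hdiv
  have hsmc : ContDiff ℝ ∞ (c • f) := hsm.const_smul c
  have hcsc : HasCompactSupport (c • f) := hcs.smul_left (f := fun _ : EuclideanSpace ℝ (Fin 3) => c)
  have hD : DataHyp 1 (c • f) :=
    ⟨one_pos, hsmc, HasRapidSpatialDecay.of_hasCompactSupport hsmc hcsc,
      VectorCalculus.IsDivFree.const_smul (hsm.differentiable (by simp)) hdiv c⟩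
  exact not_step2_of_witness hD (isGlobalX_of_global hmild hcL h0)
    (psi_lower_bound (smul_ne_zero hc.ne' hne) hsmc.continuous hcH hcL h0)
    (psi0_le one_pos (memHomSobolev_complexify_of_hasCompactSupport hsmc hcsc zero_le_one))

/-- **C04b kill.** Step 2 of the typed 2019 skeleton (inequality (e10) with `Φ_{−1/4}`) is false:
witness `ν = 1`, `v₀ = c₀ · curl(φ e₃)` small in `Ḣ^{1/2}`, its global Fujita–Kato solution. -/
theorem not_Step2_hyperSingularIneq : ¬ Literature.Claims.NS.Ramm2019.Step2_hyperSingularIneq :=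
  not_step2_of_testField contDiff_testDatum hasCompactSupport_testDatum isDivFree_testDatum
    testDatum_ne_zero

end

end Summit.NavierStokesRegularity.NavierStokesRegularity.Theorems.Ramm2019
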